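import Mathlib
import Summits.Ventures.HodgeRepro.BallGenSealed
import Summits.Ventures.HodgeRepro.RealApproxUnitary

/-!
# The sealed statement (c) on the arithmetic subgroup `U(J_K)(K) ⊂ U(2,1)`

The sealed `HeckeTranslateWedge` quantifies over every dense subgroup `Δ ≤ U(2,1)`.  The group
the route actually uses (ROUTE.md A4 / R5: "some `g ∈ G(ℚ)`") is the arithmetic one — the
`K`-points `UK K 2 = {g ∈ GL_3(K) : ḡᵀ J g = J}` of the split unitary group over a CM field `K`,
embedded in `U(2,1)` by `φ₀` (`BallGenRational.embU`) and transported to the sealed model by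
`BallGenSealed.toU21`.  With `RealApproxUnitary.dense_ratPoints` (real approximation, proved) that
subgroup is dense, so the sealed (c) applies to it verbatim: **`heckeTranslateWedge_arith`** — for
every CM field `K`, every `φ₀`, and every pair of continuous non-zero fields `F, G` on the sealed
ball there is a `K`-rational `g` and a point `z` with `(g^*F)(z) ∧ G(z) ≠ 0`.  No density
hypothesis remains.
-/

namespace HodgeRepro.BallGen.RealApprox

open Matrix Topology NumberField
open Summit.Ventures.HodgeRepro

variable {K : Type*} [Field K] [NumberField K] [IsCMField K]

/-- The arithmetic subgroup `toU21 (embU φ₀ (UK K 2)) ≤ U(2,1)` of the sealed model. -/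
def arithSubgroup (φ₀ : K →+* ℂ) : Subgroup BallModel.U21 :=
  (ratPoints K 2 φ₀).map toU21

/-- The arithmetic subgroup is dense in the sealed `U(2,1)` (real approximation transported by the
homeomorphism `toU21`). -/
theorem dense_arithSubgroup (φ₀ : K →+* ℂ) :
    Dense ((arithSubgroup φ₀ : Subgroup BallModel.U21) : Set BallModel.U21) := by
  unfold arithSubgroup
  rw [Subgroup.coe_map]
  exact toU21Homeo.surjective.denseRange.dense_image continuous_toU21 (dense_ratPoints φ₀)

/-- **The sealed statement (c) for the arithmetic subgroup, unconditionally**: for every CM field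
`K`, embedding `φ₀ : K → ℂ` and continuous non-zero `F, G : Ball → ℂ²`, some `K`-rational
`g ∈ UK K 2` and some `z` have `(Jac (g) z)ᵀ F(g z) ∧ G(z) ≠ 0`. -/
theorem heckeTranslateWedge_arith (φ₀ : K →+* ℂ) (F G : BallModel.Ball → (Fin 2 → ℂ))
    (hF : Continuous F) (hG : Continuous G) (hF0 : F ≠ 0) (hG0 : G ≠ 0) :
    ∃ g : UK K 2, ∃ z : BallModel.Ball,
      BallModel.wedge ((BallModel.Jac (toU21 (embU φ₀ g)) z).transpose.mulVec
        (F (BallModel.act (toU21 (embU φ₀ g)) z))) (G z) ≠ 0 := by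
  obtain ⟨γ, hγ, z, hz⟩ :=
    heckeTranslateWedge_of_lemmaW (arithSubgroup φ₀) (dense_arithSubgroup φ₀) F G hF hG hF0 hG0
  obtain ⟨γ', hγ', rfl⟩ := Subgroup.mem_map.1 hγ
  obtain ⟨g, rfl⟩ := (mem_ratPoints φ₀ γ').1 hγ'
  exact ⟨g, z, hz⟩

end HodgeRepro.BallGen.RealApprox
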